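import Summits.ValiantsHypothesis.ValiantsHypothesis.Theorems.SymPencilBoxFourEquality
import Summits.ValiantsHypothesis.ValiantsHypothesis.Theorems.SymPencilIsotropicKernelSquaresBilinear
import Literature.Computability.AlgebraicComplexity.StandardFamilies

/-!
# Route `SymPencil` — the cell `(11, 5, 4)` of the size-`27` kernel-package table is EMPTY
# modulo the V-side statement «no 5-dimensional singular space carries a JOINT family of four squares»
# (`--supports` stmt-ValiantsHypothesis-5674 `SdcSuperquadratic`; rung currency only — nothing here bears on `VP ≠ VNP`)

The size-`27` table (`SymPencilSdcPerFourTwentySeven`, `Cruxes/SdcSuperquadratic/CELLS-27.md` §(i)) lists the base-point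
packages of a symmetric affine determinantal representation of `per₄` of size `m ≤ 27` by
`(r, dim V, d) = (dim im bL, dim ker bL, 26 - 2r)`.  This file TYPES and PROVES the emptiness of the cell `(11, 5, 4)`
modulo ONE hypothesis `hV`, VERBATIM the statement of `noJointFamily_five_four` of val-idea-18's line
`Cruxes/SdcSuperquadratic/Lines/sing_five_classification.lean` (`Sing3 W` unfolded): «for every `5`-dimensional
`W ⊆ Sing₃` and every `(c, β)`, the JOINT four-square identity `per₄ (u + s y) = e₀ + e₁ s + s² Σ_{k<4} c_k β_k(u,y)²`
(`∀ u, ∀ y ∈ W`) fails».  That workfile proves `hV` (rev 11: sorry-free — leaves X, R2, E, R1C, R1N; the R1N branches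
TORIC / PRODUCT are the Theorems files `SymPencilPerFourOneRow{ToricR1N,ProductR1N}`), so the cell is closed at the
workfile level; porting `noJointFamily_five_four` itself under `Theorems/` is the remaining (mechanical) debt.

* **Theorem** (`false_of_rank_eleven_le_twentySeven_of_noJointFour`, the CELLS-27 §(i) template at `r = 11`, no
  `IsAlgClosed`, `hranle`/`hN` unused): in the base-point package `(D, bL, CL, κ)` of size `m ≤ 27` with
  `dim im bL = 11`, the kernel `V = ker bL` is `5`-dimensional (rank–nullity), lies in `Sing₃` (`hV4`, made
  injective-indexed by ✓ `SymPencilBoxFourEquality.subperm_vanish_inj_of_succAbove`), and carries a JOINT family of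
  `26 - 2·11 = 4` squares (✓ `SymPencilIsotropicKernelSquaresBilinear.sum_sq_of_isotropic_defect_bilinear`, `|ι'| ≤ 26`)
  — contradicting `hV`.

Honest framing: conditional on `hV` (proved in the crux workfile, not yet under `Theorems/`); the other cells of the table are
untouched; the window `27 ≤ sdc(per₄) ≤ 29` is UNCHANGED; stmt-5674 `SdcSuperquadratic` stays open; `VP ≠ VNP` is not moved; no
summit statement is proved here.  No definitions, no named facts. [folklore]
-/

noncomputable section

-- single-conjunct layout: Sub = Summit, duplicated namespace component intended
set_option linter.dupNamespace false

namespace Summit.ValiantsHypothesis.ValiantsHypothesis.Theorems.SymPencilSdcPerFourCellElevenFive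

open Matrix MvPolynomial Module
open Literature.Computability.AlgebraicComplexity
open Summit.ValiantsHypothesis.ValiantsHypothesis.Theorems.SymPencilBoxFourEquality
open Summit.ValiantsHypothesis.ValiantsHypothesis.Theorems.SymPencilIsotropicKernelSquaresBilinear

/-- **The cell `(11, 5, 4)` of the size-`27` table is empty modulo «no joint four-square family on a `5`-dimensional
singular space»** (the CELLS-27 §(i) template at `r = 11`; hypotheses exactly as exported by
`SymPencilPerFourBasePointPackage.basepoint_package_of_isSymm_isAffineDetRepr_perPoly_four`). [folklore] -/
theorem false_of_rank_eleven_le_twentySeven_of_noJointFour (K : Type*) [Field K] [CharZero K]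
    {m : ℕ} (hm : m ≤ 27)
    {i₀ : Fin m} {D : Matrix {i // i ≠ i₀} {i // i ≠ i₀} K}
    {bL : (Fin 4 × Fin 4 → K) →ₗ[K] ({i // i ≠ i₀} → K)}
    {CL : (Fin 4 × Fin 4 → K) →ₗ[K] Matrix {i // i ≠ i₀} {i // i ≠ i₀} K} {κ : K}
    (hD : IsUnit D.det) (hDs : Dᵀ = D) (hCs : ∀ z, (CL z)ᵀ = CL z) (hκ : κ ≠ 0)
    (hi : ∀ z, bL z ⬝ᵥ D⁻¹ *ᵥ bL z = 0)
    (hii : ∀ z, bL z ⬝ᵥ (D⁻¹ * CL z * D⁻¹) *ᵥ bL z = 0)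
    (hiii : ∀ z, D.det * (bL z ⬝ᵥ (D⁻¹ * CL z * D⁻¹ * CL z * D⁻¹) *ᵥ bL z) =
      -(κ * eval z (perPoly (Fin 4) K)))
    (hV4 : ∀ x ∈ LinearMap.ker bL, ∀ r c : Fin 4,
      ((Matrix.of fun i j => x (i, j)).submatrix r.succAbove c.succAbove).permanent = 0)
    (hcard : Fintype.card {i // i ≠ i₀} + 1 = m)
    (_hranle : 2 * finrank K (LinearMap.range bL) ≤ Fintype.card {i // i ≠ i₀})
    (hrn : finrank K (LinearMap.range bL) + finrank K (LinearMap.ker bL) = 16)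
    (_hN : ∀ v, bL v = 0 → IsUnit (D + CL v).det ∧ ∀ (z : Fin 4 × Fin 4 → K) (s : K),
      κ * eval (v + s • z) (perPoly (Fin 4) K) =
        (Matrix.fromBlocks ((s * 0) • (1 : Matrix Unit Unit K))
          (Matrix.replicateRow Unit (s • bL z)) (Matrix.replicateCol Unit (s • bL z))
          (D + CL v + s • CL z)).det)
    (hV : ∀ W : Submodule K (Fin 4 × Fin 4 → K),
      (∀ x ∈ W, ∀ (r c : Fin 3 → Fin 4), Function.Injective r → Function.Injective c →
        ((Matrix.of fun i j => x (i, j)).submatrix r c).permanent = 0) →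
      finrank K W = 5 →
      ∀ (c : Fin 4 → K) (β : Fin 4 → ((Fin 4 × Fin 4 → K) →ₗ[K] (Fin 4 × Fin 4 → K) →ₗ[K] K)),
        ¬ (∀ u : Fin 4 × Fin 4 → K, ∀ y ∈ W, ∃ e₀ e₁ : K, ∀ s : K,
          eval (u + s • y) (perPoly (Fin 4) K) = e₀ + s * e₁ + s ^ 2 * ∑ k, c k * (β k u y) ^ 2))
    (h11 : finrank K (LinearMap.range bL) = 11) : False := by
  classical
  have hk5 : finrank K (LinearMap.ker bL) = 5 := by omega
  -- the joint family of `4` squares along the kernel (`|ι'| = m - 1 ≤ 26 = 2·11 + 4`)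
  obtain ⟨c, β, hcβ⟩ := sum_sq_of_isotropic_defect_bilinear hD hDs bL CL hCs
    (fun z => eval z (perPoly (Fin 4) K)) hκ hi hii hiii 4 (by omega)
  have hV3 : ∀ x ∈ LinearMap.ker bL, ∀ (r c : Fin 3 → Fin 4), Function.Injective r →
      Function.Injective c → ((Matrix.of fun i j => x (i, j)).submatrix r c).permanent = 0 :=
    fun x hx r c hr hc => subperm_vanish_inj_of_succAbove x (hV4 x hx) r c hr hc
  exact hV (LinearMap.ker bL) hV3 hk5 c β fun u y hy => hcβ u y (LinearMap.mem_ker.1 hy)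

end Summit.ValiantsHypothesis.ValiantsHypothesis.Theorems.SymPencilSdcPerFourCellElevenFive
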